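import Summits.Ventures.Crystal3D.Theorems.StickyWulffConstantGenericWallFloorHRowEndCases
import Summits.Ventures.Crystal3D.Theorems.StickyWulffConstantGenericWallFloorHRowEndTrig
import Summits.Ventures.Crystal3D.Theorems.StickyWulffConstantGenericWallFloorEndBallUniverse
import Summits.Ventures.Crystal3D.Theorems.StickyWulffConstantNoReconstructionGainPredSlotBudgetRaisedCore
import HarnessLib

/-!
# The h-row END theorem in the model direction `u₀`, II: the FAR case `dist(p′, p) ≥ √2` and the assembly `hRowEnd_core` (core of TRACK 2′ for `HRowEndFarApart (3/4)`)
# (crux `GenericWallFloor`, stmt-Ventures-19480, kernel G; machine owner 19480-p2 g14, 2026-08-29)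

HONEST FRAMING. Venture `Summits/Ventures/Crystal3D` (cell `crystal3d-full`), route `route-Ventures-StickyWulffConstant`, helper for the crux
`GenericWallFloor` (stmt-Ventures-19480) / consumer `TextureLiminfV5` (stmt-Ventures-23912).  Standard axioms; no `sorry`; F-C1 not moved.
Ingredients: √2-gap (`…KissingGap`), star trigonometry (`…HRowEndTrig`), the adjacent cases (`…HRowEndCases`), dozen rigidity.

THE ARGUMENT (`hRowEnd_core`).  Frame `F`, row direction `F u₀`, h-full predecessor `p`, end ball `e = p + F u₀`; a strongly certified `⟨F′, q, 0⟩` at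
`e`, predecessor `p′ = e − F′ q`, `F′·Λ₀` apart from `F·Λ₀` and its basal twin, RISING (`⟪F u₀, ζ⟫ ≥ ¾`, `⟪F′q, ζ⟫ ≥ ⅜` ⇒ the model direction
`d = F⁻¹ F′q` has `d 0 > −1/3`, `inner_gt_of_rising`).  √2-gap at the h-full `p` (`dist_eq_one_or_sqrt_two_le_of_hcpDozen`): `p′ = p` / `p′ = p + F tᵢ`
(`i = 1..4`, `hcp_adjacent_cases`) — `…HRowEndCases` — or `dist(p′,p) ≥ √2` (`case_far`, here): then `d 0 ≤ 0`, and each of the four star balls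
`p + F tᵢ` is either in `D′` (`⟪tᵢ − u₀, d⟫ = −½`) or `≥ √2` from `p′` (`⟪tᵢ − u₀, d⟫ ≥ 0`) (`star_constraint`); `star_constraints_le` then forces
`d 0 ≤ −1/3` — contradicting the rise — or the OCTAHEDRAL configuration `d ∈ {oU, oL}` with two star balls in `D′`, whose three independent shared
slots make `F′·Λ₀` coaxial with `F·Λ₀` or its basal twin (`case_octa`) — excluded by APARTNESS.
WHAT THIS IS NOT: the `∀ u` statement (symmetry reduction: `…HRowEndFarApartHolds`); F-C1 not moved.
-/

noncomputable section

namespace Summit.Ventures.Crystal3D.Theorems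

open Finset
open Literature.MathematicalPhysics.StatisticalMechanics
open scoped InnerProductSpace

namespace HRowEndModel

/-! ### The octahedral shared slots `m₂ = (−½, −√3/6, −√(2/3))` (the lower slot `(−1,0,0)`) and `m₃ = (−½, √3/2, 0)` (the in-plane slot `(0,−1,1)`) -/


/-- Coordinates of `m₂`. -/
theorem m₂_apply :
    (barlowPos 1 (Real.sqrt (2 / 3)) constHagg (-1) 0 0) 0 = -(1 / 2) ∧ (barlowPos 1 (Real.sqrt (2 / 3)) constHagg (-1) 0 0) 1 = -(Real.sqrt 3 / 6) ∧
      (barlowPos 1 (Real.sqrt (2 / 3)) constHagg (-1) 0 0) 2 = -Real.sqrt (2 / 3) :=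
  ⟨by simp [haggLabel_const]; ring, by simp [haggLabel_const]; ring, by simp⟩
/-- Coordinates of `m₃`. -/
theorem m₃_apply : (barlowPos 1 (Real.sqrt (2 / 3)) constHagg 0 (-1) 1) 0 = -(1 / 2) ∧ (barlowPos 1 (Real.sqrt (2 / 3)) constHagg 0 (-1) 1) 1 = Real.sqrt 3 / 2 ∧
    (barlowPos 1 (Real.sqrt (2 / 3)) constHagg 0 (-1) 1) 2 = 0 :=
  ⟨by norm_num, by simp, by simp⟩
/-- `m₂ ∈ fccSlots`. -/
theorem m₂_mem : barlowPos 1 (Real.sqrt (2 / 3)) constHagg (-1) 0 0 ∈ fccSlots := by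
  rw [fccSlots, mem_image]; exact ⟨(-1, 0, 0), by simp [fccSlotTriples], rfl⟩
/-- `m₃ ∈ fccSlots`. -/
theorem m₃_mem : barlowPos 1 (Real.sqrt (2 / 3)) constHagg 0 (-1) 1 ∈ fccSlots := by
  rw [fccSlots, mem_image]; exact ⟨(0, -1, 1), by simp [fccSlotTriples], rfl⟩

section Core

variable {X : Finset (EuclideanSpace ℝ (Fin 3))} (hX : ∀ p ∈ X, ∀ q ∈ X, p ≠ q → 1 ≤ dist p q)
  {F F' : EuclideanSpace ℝ (Fin 3) ≃ₗᵢ[ℝ] EuclideanSpace ℝ (Fin 3)} {q n₀ d p : EuclideanSpace ℝ (Fin 3)}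
  (hq : q ∈ fccSlots) (hn : n₀ = 0 ∨ ‖n₀‖ = 1)
  (hmenu : ∀ w ∈ fccSlots, ⟪F' w, n₀⟫_ℝ = 0 ∨ ⟪F' w, n₀⟫_ℝ = Real.sqrt (2 / 3) ∨ ⟪F' w, n₀⟫_ℝ = -Real.sqrt (2 / 3))
  (hposOr : n₀ = 0 ∨ 0 < ⟪F' q, n₀⟫_ℝ) (hFd : F d = F' q) (hd1 : ‖d‖ = 1)
  (hball : ∀ t ∈ hcpSlots, p + F t ∈ X) (hpX : p ∈ X)
  (hdoz : ∀ x ∈ X, x ≠ p + F u₀ - F d → dist x (p + F u₀ - F d) < Real.sqrt 2 → InDoz F' n₀ (x - (p + F u₀ - F d)))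
  (hA : F' '' fccStacking 1 (Real.sqrt (2 / 3)) ≠ F '' fccStacking 1 (Real.sqrt (2 / 3)))
  (hB : F' '' fccStacking 1 (Real.sqrt (2 / 3)) ≠
    (twinFrame F (F (EuclideanSpace.single (2 : Fin 3) (1 : ℝ)))) '' fccStacking 1 (Real.sqrt (2 / 3)))

/-- The octahedral shared slots `oL, m₂, m₃`: `t₂ − u₀ + oL = m₂`, `t₃ − u₀ + oL = m₃`, mirror versions, memberships and independence. -/
theorem octa_slots :
    t₂ - u₀ + oL = barlowPos 1 (Real.sqrt (2 / 3)) constHagg (-1) 0 0 ∧ t₃ - u₀ + oL = barlowPos 1 (Real.sqrt (2 / 3)) constHagg 0 (-1) 1 ∧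
    t₂ - u₀ + oU = basalMirror (barlowPos 1 (Real.sqrt (2 / 3)) constHagg (-1) 0 0) ∧
    t₄ - u₀ + oU = basalMirror (barlowPos 1 (Real.sqrt (2 / 3)) constHagg 0 (-1) 1) ∧
    LinearIndependent ℝ ![barlowPos 1 (Real.sqrt (2 / 3)) constHagg (-1) 0 0, oL, barlowPos 1 (Real.sqrt (2 / 3)) constHagg 0 (-1) 1] := by
  have e1 : t₂ - u₀ + oL = (barlowPos 1 (Real.sqrt (2 / 3)) constHagg (-1) 0 0) :=
    eq_of_apply_fin_three (by simp [t₂_apply.1, u₀_apply.1, oL_apply.1]; norm_num)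
      (by simp [t₂_apply.2.1, u₀_apply.2.1, oL_apply.2.1]; ring)
      (by simp [t₂_apply.2.2, u₀_apply.2.2, oL_apply.2.2])
  have e2 : t₃ - u₀ + oL = (barlowPos 1 (Real.sqrt (2 / 3)) constHagg 0 (-1) 1) :=
    eq_of_apply_fin_three (by simp [t₃_apply.1, u₀_apply.1, oL_apply.1]; norm_num)
      (by simp [t₃_apply.2.1, u₀_apply.2.1, oL_apply.2.1]; ring)
      (by simp [t₃_apply.2.2, u₀_apply.2.2, oL_apply.2.2])
  have e3 : t₂ - u₀ + oU = basalMirror (barlowPos 1 (Real.sqrt (2 / 3)) constHagg (-1) 0 0) :=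
    eq_of_apply_fin_three (by simp [t₂_apply.1, u₀_apply.1, oU_apply.1, basalMirror_apply_coord]; norm_num)
      (by simp [t₂_apply.2.1, u₀_apply.2.1, oU_apply.2.1, basalMirror_apply_coord]; ring)
      (by simp [t₂_apply.2.2, u₀_apply.2.2, oU_apply.2.2, basalMirror_apply_coord])
  have e4 : t₄ - u₀ + oU = basalMirror (barlowPos 1 (Real.sqrt (2 / 3)) constHagg 0 (-1) 1) :=
    eq_of_apply_fin_three (by simp [t₄_apply.1, u₀_apply.1, oU_apply.1, basalMirror_apply_coord]; norm_num)
      (by simp [t₄_apply.2.1, u₀_apply.2.1, oU_apply.2.1, basalMirror_apply_coord]; ring)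
      (by simp [t₄_apply.2.2, u₀_apply.2.2, oU_apply.2.2, basalMirror_apply_coord])
  refine ⟨e1, e2, e3, e4, ?_⟩
  -- independence: unit vectors, `⟪·, m₂ + m₃⟫ = 1` for all three, pairwise distinct
  have h3 : Real.sqrt 3 * Real.sqrt 3 = 3 := Real.mul_self_sqrt (by norm_num)
  have h23 : Real.sqrt (2 / 3) * Real.sqrt (2 / 3) = 2 / 3 := Real.mul_self_sqrt (by norm_num)
  have i12 : ⟪oL, (barlowPos 1 (Real.sqrt (2 / 3)) constHagg (-1) 0 0)⟫_ℝ = 1 / 2 := by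
    rw [inner_fin3, oL_apply.1, oL_apply.2.1, oL_apply.2.2, m₂_apply.1, m₂_apply.2.1, m₂_apply.2.2]; nlinarith [h3, h23]
  have i13 : ⟪oL, (barlowPos 1 (Real.sqrt (2 / 3)) constHagg 0 (-1) 1)⟫_ℝ = 1 / 2 := by
    rw [inner_fin3, oL_apply.1, oL_apply.2.1, oL_apply.2.2, m₃_apply.1, m₃_apply.2.1, m₃_apply.2.2]; nlinarith [h3, h23]
  have i23 : ⟪(barlowPos 1 (Real.sqrt (2 / 3)) constHagg (-1) 0 0), (barlowPos 1 (Real.sqrt (2 / 3)) constHagg 0 (-1) 1)⟫_ℝ = 0 := by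
    rw [inner_fin3, m₂_apply.1, m₂_apply.2.1, m₂_apply.2.2, m₃_apply.1, m₃_apply.2.1, m₃_apply.2.2]; nlinarith [h3, h23]
  have n1 := norm_eq_one_of_mem_fccSlots oL_mem
  have n2 := norm_eq_one_of_mem_fccSlots m₂_mem
  have n3' := norm_eq_one_of_mem_fccSlots m₃_mem
  have s1 : ⟪oL, oL⟫_ℝ = 1 := by rw [real_inner_self_eq_norm_sq, n1, one_pow]
  have s2 : ⟪(barlowPos 1 (Real.sqrt (2 / 3)) constHagg (-1) 0 0), (barlowPos 1 (Real.sqrt (2 / 3)) constHagg (-1) 0 0)⟫_ℝ = 1 := by rw [real_inner_self_eq_norm_sq, n2, one_pow]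
  have s3 : ⟪(barlowPos 1 (Real.sqrt (2 / 3)) constHagg 0 (-1) 1), (barlowPos 1 (Real.sqrt (2 / 3)) constHagg 0 (-1) 1)⟫_ℝ = 1 := by rw [real_inner_self_eq_norm_sq, n3', one_pow]
  refine linearIndependent_of_unit_of_inner_eq (e := (barlowPos 1 (Real.sqrt (2 / 3)) constHagg (-1) 0 0) + (barlowPos 1 (Real.sqrt (2 / 3)) constHagg 0 (-1) 1)) n2 n1 n3' one_ne_zero ?_ ?_ ?_ ?_ ?_ ?_
  · rw [inner_add_right, s2, i23]; norm_num
  · rw [inner_add_right, i12, i13]; norm_num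
  · rw [inner_add_right, real_inner_comm (barlowPos 1 (Real.sqrt (2 / 3)) constHagg (-1) 0 0) (barlowPos 1 (Real.sqrt (2 / 3)) constHagg 0 (-1) 1), i23, s3]; norm_num
  · intro h; rw [h] at i12; rw [real_inner_self_eq_norm_sq, n1] at i12; norm_num at i12
  · intro h; rw [h, s3] at i23; norm_num at i23
  · intro h; rw [h, s3] at i13; norm_num at i13

include hn hmenu hd1 hball hdoz in
/-- The star constraint of one adjacent h-slot `t` when `dist(p′,p) ≥ √2`: `⟪t − u₀, d⟫ ≥ 0` (the star ball is `≥ √2` away from `p′`)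
or `= −½` (it belongs to `D′`). -/
theorem star_constraint (hfar : Real.sqrt 2 ≤ dist (p + F u₀ - F d) p) {t : EuclideanSpace ℝ (Fin 3)} (ht : t ∈ hcpSlots)
    (htu : ⟪t, u₀⟫_ℝ = 1 / 2) : 0 ≤ ⟪t - u₀, d⟫_ℝ ∨ ⟪t - u₀, d⟫_ℝ = -1 / 2 := by
  have hu1 := norm_eq_one_of_mem_fccSlots u₀_mem
  have hs1 : ‖t - u₀‖ = 1 := TailResidue.norm_sub_eq_one_of_inner_half (norm_eq_one_of_mem_hcpSlots ht) hu1 htu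
  have hsq : ‖t - u₀ + d‖ ^ 2 = 2 + 2 * ⟪t - u₀, d⟫_ℝ := by rw [@norm_add_sq_real, hs1, hd1]; ring
  have key : p + F t - (p + F u₀ - F d) = F (t - u₀ + d) := by rw [map_add, map_sub]; abel
  have hdist : dist (p + F t) (p + F u₀ - F d) = ‖t - u₀ + d‖ := by rw [dist_eq_norm, key, LinearIsometryEquiv.norm_map]
  rcases lt_or_ge (dist (p + F t) (p + F u₀ - F d)) (Real.sqrt 2) with hlt | hge
  · right
    have hne : p + F t ≠ p + F u₀ - F d := by
      intro h
      have h1 : dist (p + F u₀ - F d) p = 1 := by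
        rw [← h, dist_eq_norm, add_sub_cancel_left, LinearIsometryEquiv.norm_map, norm_eq_one_of_mem_hcpSlots ht]
      rw [h1] at hfar
      have h2 : (1 : ℝ) < Real.sqrt 2 := by
        rw [show (1 : ℝ) = Real.sqrt 1 by simp]; exact Real.sqrt_lt_sqrt (by norm_num) (by norm_num)
      linarith
    have hD := hdoz (p + F t) (hball t ht) hne hlt
    rw [key] at hD
    have hn1 := norm_of_inDoz hn hmenu hD
    rw [LinearIsometryEquiv.norm_map] at hn1
    rw [hn1] at hsq; linarith
  · left
    rw [hdist] at hge
    have : 2 ≤ ‖t - u₀ + d‖ ^ 2 := by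
      have h' := pow_le_pow_left₀ (Real.sqrt_nonneg 2) hge 2
      rwa [Real.sq_sqrt (by norm_num : (0 : ℝ) ≤ 2)] at h'
    linarith

/-- The four star constraints and the norm, in the rational variables `(d 0, (√3/2)·d 1, √(2/3)·d 2)`. -/
theorem star_coords (d : EuclideanSpace ℝ (Fin 3)) :
    ⟪t₁ - u₀, d⟫_ℝ = -(d 0) / 2 + Real.sqrt 3 / 2 * d 1 ∧ ⟪t₂ - u₀, d⟫_ℝ = -(d 0) / 2 - Real.sqrt 3 / 2 * d 1 ∧
    ⟪t₃ - u₀, d⟫_ℝ = -(d 0) / 2 + Real.sqrt 3 / 2 * d 1 / 3 + Real.sqrt (2 / 3) * d 2 ∧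
    ⟪t₄ - u₀, d⟫_ℝ = -(d 0) / 2 + Real.sqrt 3 / 2 * d 1 / 3 - Real.sqrt (2 / 3) * d 2 ∧
    ‖d‖ ^ 2 = d 0 ^ 2 + 4 / 3 * (Real.sqrt 3 / 2 * d 1) ^ 2 + 3 / 2 * (Real.sqrt (2 / 3) * d 2) ^ 2 := by
  have h3 : Real.sqrt 3 ^ 2 = 3 := Real.sq_sqrt (by norm_num)
  have h23 : Real.sqrt (2 / 3) ^ 2 = 2 / 3 := Real.sq_sqrt (by norm_num)
  refine ⟨?_, ?_, ?_, ?_, ?_⟩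
  · rw [inner_sub_left, inner_fin3, inner_fin3, t₁_apply.1, t₁_apply.2.1, t₁_apply.2.2, u₀_apply.1, u₀_apply.2.1,
      u₀_apply.2.2]; ring
  · rw [inner_sub_left, inner_fin3, inner_fin3, t₂_apply.1, t₂_apply.2.1, t₂_apply.2.2, u₀_apply.1, u₀_apply.2.1,
      u₀_apply.2.2]; ring
  · rw [inner_sub_left, inner_fin3, inner_fin3, t₃_apply.1, t₃_apply.2.1, t₃_apply.2.2, u₀_apply.1, u₀_apply.2.1,
      u₀_apply.2.2]; ring
  · rw [inner_sub_left, inner_fin3, inner_fin3, t₄_apply.1, t₄_apply.2.1, t₄_apply.2.2, u₀_apply.1, u₀_apply.2.1,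
      u₀_apply.2.2]; ring
  · rw [norm_sq_fin3, mul_pow, mul_pow, div_pow, h3, h23]; ring

include hq hn hmenu hposOr hFd hd1 hball hdoz hA hB in
/-- **The OCTAHEDRAL configuration is coaxial**: `d = oU` (with the star balls `p + F t₂`, `p + F t₄` in `D′`) pins `F′·Λ₀` to the
basal twin of `F·Λ₀`; `d = oL` (with `p + F t₂`, `p + F t₃` in `D′`) pins it to `F·Λ₀` — both excluded by apartness. -/
theorem case_octa (h2 : InDoz F' n₀ (F (t₂ - u₀ + d)))
    (hU : d = oU → InDoz F' n₀ (F (t₄ - u₀ + d))) (hL : d = oL → InDoz F' n₀ (F (t₃ - u₀ + d)))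
    (hdo : d = oU ∨ d = oL) : False := by
  have hu1 := norm_eq_one_of_mem_fccSlots u₀_mem
  obtain ⟨e1, e2, e3, e4, hind⟩ := octa_slots
  have hmd : InDoz F' n₀ (F d) := by
    have := inDoz_of_unit hdoz (hball u₀ u₀_hcp) (by rw [sub_self, zero_add]; exact hd1)
    rwa [sub_self, zero_add] at this
  have n2 : ‖F (t₂ - u₀ + d) - F d‖ = 1 := by
    rw [← map_sub, LinearIsometryEquiv.norm_map, show t₂ - u₀ + d - d = t₂ - u₀ by abel]
    exact TailResidue.norm_sub_eq_one_of_inner_half (norm_eq_one_of_mem_fccSlots t₂_mem) hu1 inner_t₂_u₀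
  rcases hdo with hdo | hdo
  · have h4 := hU hdo
    have n4 : ‖F (t₄ - u₀ + d) - F d‖ = 1 := by
      rw [← map_sub, LinearIsometryEquiv.norm_map, show t₄ - u₀ + d - d = t₄ - u₀ by abel]
      exact TailResidue.norm_sub_eq_one_of_inner_half norm_t₄ hu1 inner_t₄_u₀
    subst hdo
    rw [e3] at h2 n2; rw [e4] at h4 n4
    exact coaxial_contra_twin hq hn hmenu hposOr hFd hB m₂_mem oL_mem m₃_mem hind h2 hmd h4 n2 (Or.inr rfl) n4
  · have h3 := hL hdo
    have n3 : ‖F (t₃ - u₀ + d) - F d‖ = 1 := by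
      rw [← map_sub, LinearIsometryEquiv.norm_map, show t₃ - u₀ + d - d = t₃ - u₀ by abel]
      exact TailResidue.norm_sub_eq_one_of_inner_half (norm_eq_one_of_mem_fccSlots t₃_mem) hu1 inner_t₃_u₀
    subst hdo
    rw [e1] at h2 n2; rw [e2] at h3 n3
    exact coaxial_contra hq hn hmenu hposOr hFd hA m₂_mem oL_mem m₃_mem hind h2 hmd h3 n2 (Or.inr rfl) n3

include hq hn hmenu hposOr hFd hd1 hball hdoz hA hB in
/-- **(C4) `dist(p′, p) ≥ √2`**: the star constraints force `d 0 ≤ −1/3`, or the octahedral configuration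
(coaxial — excluded by apartness). -/
theorem case_far (hfar : Real.sqrt 2 ≤ dist (p + F u₀ - F d) p) (hd0 : -(1 : ℝ) / 3 < d 0) : False := by
  have hc : 0 < Real.sqrt (2 / 3) := sqrt23_pos
  have h3 : Real.sqrt 3 * Real.sqrt 3 = 3 := Real.mul_self_sqrt (by norm_num)
  have h23 : Real.sqrt (2 / 3) * Real.sqrt (2 / 3) = 2 / 3 := Real.mul_self_sqrt (by norm_num)
  have hu1 := norm_eq_one_of_mem_fccSlots u₀_mem
  -- `d 0 ≤ 0`
  have hd00 : d 0 ≤ 0 := by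
    have h1 : dist (p + F u₀ - F d) p = ‖u₀ - d‖ := by
      rw [dist_eq_norm, show p + F u₀ - F d - p = F (u₀ - d) by rw [map_sub]; abel, LinearIsometryEquiv.norm_map]
    rw [h1] at hfar
    have h2 : 2 ≤ ‖u₀ - d‖ ^ 2 := by
      have h' := pow_le_pow_left₀ (Real.sqrt_nonneg 2) hfar 2
      rwa [Real.sq_sqrt (by norm_num : (0 : ℝ) ≤ 2)] at h'
    rw [@norm_sub_sq_real, hu1, hd1, real_inner_comm, inner_u₀_eq] at h2
    linarith
  obtain ⟨c1, c2, c3, c4, cn⟩ := star_coords d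
  have s1 := star_constraint hn hmenu hd1 hball hdoz hfar t₁_hcp inner_t₁_u₀
  have s2 := star_constraint hn hmenu hd1 hball hdoz hfar t₂_hcp inner_t₂_u₀
  have s3 := star_constraint hn hmenu hd1 hball hdoz hfar t₃_hcp inner_t₃_u₀
  have s4 := star_constraint hn hmenu hd1 hball hdoz hfar t₄_hcp inner_t₄_u₀
  rw [c1] at s1; rw [c2] at s2; rw [c3] at s3; rw [c4] at s4
  have hnorm : d 0 ^ 2 + 4 / 3 * (Real.sqrt 3 / 2 * d 1) ^ 2 + 3 / 2 * (Real.sqrt (2 / 3) * d 2) ^ 2 = 1 := by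
    rw [← cn, hd1, one_pow]
  rcases star_constraints_le hnorm hd00 s1 s2 s3 s4 with hle | ⟨hz0, hP1, hQ1⟩
  · linarith
  -- the octahedral configuration: `d 1 = √3/3`, `d 2 = ±√(2/3)`
  have hd1' : d 1 = Real.sqrt 3 / 3 := by
    have h5 : Real.sqrt 3 * d 1 = 1 := by linarith
    have h6 : d 1 = Real.sqrt 3 * (Real.sqrt 3 * d 1) / 3 := by rw [← mul_assoc, h3]; ring
    rw [h6, h5, mul_one]
  -- the star ball `p + F t₂` lies in `D′`
  have hS2 : InDoz F' n₀ (F (t₂ - u₀ + d)) := by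
    refine inDoz_of_unit hdoz (hball t₂ t₂_hcp) ?_
    have h7 : ‖t₂ - u₀ + d‖ ^ 2 = 1 := by
      rw [@norm_add_sq_real, TailResidue.norm_sub_eq_one_of_inner_half (norm_eq_one_of_mem_fccSlots t₂_mem) hu1 inner_t₂_u₀, hd1, c2, hz0, hP1]
      norm_num
    exact (pow_eq_one_iff_of_nonneg (norm_nonneg (t₂ - u₀ + d)) two_ne_zero).1 h7
  rcases hQ1 with hQ1 | hQ1
  · have hd2' : d 2 = Real.sqrt (2 / 3) := by
      have h9 : Real.sqrt (2 / 3) * (d 2 - Real.sqrt (2 / 3)) = 0 := by rw [mul_sub, hQ1, h23, sub_self]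
      exact sub_eq_zero.1 ((mul_eq_zero.1 h9).resolve_left hc.ne')
    have hdo : d = oU := eq_of_apply_fin_three (by rw [hz0, oU_apply.1]) (by rw [hd1', oU_apply.2.1]) (by rw [hd2', oU_apply.2.2])
    refine case_octa hq hn hmenu hposOr hFd hd1 hball hdoz hA hB hS2 (fun _ => ?_) (fun h => ?_) (Or.inl hdo)
    · refine inDoz_of_unit hdoz (hball t₄ t₄_hcp) ?_
      have h7 : ‖t₄ - u₀ + d‖ ^ 2 = 1 := by
        rw [@norm_add_sq_real, TailResidue.norm_sub_eq_one_of_inner_half norm_t₄ hu1 inner_t₄_u₀, hd1, c4, hz0, hP1, hQ1]; norm_num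
      exact (pow_eq_one_iff_of_nonneg (norm_nonneg (t₄ - u₀ + d)) two_ne_zero).1 h7
    · exfalso
      have h8 := congrArg (fun v : EuclideanSpace ℝ (Fin 3) => v 2) h
      simp only at h8
      rw [hd2', oL_apply.2.2] at h8; linarith
  · have hd2' : d 2 = -Real.sqrt (2 / 3) := by
      have h9 : Real.sqrt (2 / 3) * (d 2 + Real.sqrt (2 / 3)) = 0 := by rw [mul_add, hQ1, h23]; norm_num
      exact eq_neg_of_add_eq_zero_left ((mul_eq_zero.1 h9).resolve_left hc.ne')
    have hdo : d = oL := eq_of_apply_fin_three (by rw [hz0, oL_apply.1]) (by rw [hd1', oL_apply.2.1]) (by rw [hd2', oL_apply.2.2])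
    refine case_octa hq hn hmenu hposOr hFd hd1 hball hdoz hA hB hS2 (fun h => ?_) (fun _ => ?_) (Or.inr hdo)
    · exfalso
      have h8 := congrArg (fun v : EuclideanSpace ℝ (Fin 3) => v 2) h
      simp only at h8
      rw [hd2', oU_apply.2.2] at h8; linarith
    · refine inDoz_of_unit hdoz (hball t₃ t₃_hcp) ?_
      have h7 : ‖t₃ - u₀ + d‖ ^ 2 = 1 := by
        rw [@norm_add_sq_real, TailResidue.norm_sub_eq_one_of_inner_half (norm_eq_one_of_mem_fccSlots t₃_mem) hu1 inner_t₃_u₀, hd1, c3, hz0, hP1, hQ1]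
        norm_num
      exact (pow_eq_one_iff_of_nonneg (norm_nonneg (t₃ - u₀ + d)) two_ne_zero).1 h7

end Core

/-! ### The core theorem -/

/-- **h-ROW END, MODEL DIRECTION.**  Frame `F`, row direction `F u₀`, end ball `e` with `e − F u₀ ∈ X` h-FULL; a strongly certified `⟨F′, q, 0⟩` at `e`
with `F′·Λ₀` apart from `F·Λ₀` and from `(twinFrame F (F e₃))·Λ₀` cannot rise: `⟪F u₀, ζ⟫ ≥ ¾` and `⟪F′ q, ζ⟫ ≥ ⅜` are contradictory. -/
theorem hRowEnd_core {X : Finset (EuclideanSpace ℝ (Fin 3))} (hX : ∀ p ∈ X, ∀ q ∈ X, p ≠ q → 1 ≤ dist p q)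
    {F F' : EuclideanSpace ℝ (Fin 3) ≃ₗᵢ[ℝ] EuclideanSpace ℝ (Fin 3)} {q ζ e : EuclideanSpace ℝ (Fin 3)} (hq : q ∈ fccSlots) (hζ : ‖ζ‖ = 1)
    (hsteep : (3 : ℝ) / 4 ≤ ⟪F u₀, ζ⟫_ℝ) (hrise : (3 : ℝ) / 8 ≤ ⟪F' q, ζ⟫_ℝ)
    (hA : F' '' fccStacking 1 (Real.sqrt (2 / 3)) ≠ F '' fccStacking 1 (Real.sqrt (2 / 3)))
    (hB : F' '' fccStacking 1 (Real.sqrt (2 / 3)) ≠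
      (twinFrame F (F (EuclideanSpace.single (2 : Fin 3) (1 : ℝ)))) '' fccStacking 1 (Real.sqrt (2 / 3)))
    (hp0 : e - F u₀ ∈ X) (hfull : ∀ s ∈ hcpSlots, e - F u₀ + F s ∈ X) (hcert : WalkCertified12 X e ⟨F', q, 0⟩) : False := by
  set p := e - F u₀ with hp
  set d := F.symm (F' q) with hd
  have hFd : F d = F' q := by rw [hd, LinearIsometryEquiv.apply_symm_apply]
  have hd1 : ‖d‖ = 1 := by rw [hd, LinearIsometryEquiv.norm_map, LinearIsometryEquiv.norm_map, norm_eq_one_of_mem_fccSlots hq]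
  have hu1 : ‖u₀‖ = 1 := norm_eq_one_of_mem_fccSlots u₀_mem
  have heq_e : e = p + F u₀ := by rw [hp, sub_add_cancel]
  have hball : ∀ t ∈ hcpSlots, p + F t ∈ X := fun t ht => hfull t ht
  -- rising ⇒ `d 0 > −1/3`
  have hd0 : -(1 : ℝ) / 3 < d 0 := by
    have h1 : ‖F u₀‖ = 1 := by rw [LinearIsometryEquiv.norm_map, hu1]
    have h2 : ‖F' q‖ = 1 := by rw [LinearIsometryEquiv.norm_map, norm_eq_one_of_mem_fccSlots hq]
    have := inner_gt_of_rising h1 h2 hζ hsteep hrise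
    rwa [← hFd, LinearIsometryEquiv.inner_map_map, real_inner_comm, inner_u₀_eq] at this
  -- the dozen of `p′`
  obtain ⟨n₀, hn, hmenu, -, hposOr, hp'X, hdoz⟩ := dozen_of_certified12 hX hcert
  have hp'eq : e - F' q = p + F u₀ - F d := by rw [heq_e, hFd]
  rw [hp'eq] at hp'X hdoz
  by_cases hpp : p + F u₀ - F d = p
  · -- (C1)
    have hdu : d = u₀ := by
      apply F.injective
      have h1 : F u₀ - F d = (p + F u₀ - F d) - p := by abel
      rw [hpp, sub_self] at h1
      exact (sub_eq_zero.1 h1).symm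
    exact case_self hn hmenu hposOr hFd hball hdoz hdu
  rcases dist_eq_one_or_sqrt_two_le_of_hcpDozen hX hball hp'X hpp with ⟨s, hs, hps⟩ | hfar
  · have hds : d = u₀ - s := by
      apply F.injective
      have h1 : F d = p + F u₀ - (p + F u₀ - F d) := by abel
      rw [hps] at h1
      rw [h1, map_sub]; abel
    have hsu : ⟪s, u₀⟫_ℝ = 1 / 2 := by
      have h1 : ‖u₀ - s‖ ^ 2 = 1 := by rw [← hds, hd1, one_pow]
      rw [@norm_sub_sq_real, hu1, norm_eq_one_of_mem_hcpSlots hs, real_inner_comm] at h1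
      linarith
    rcases hcp_adjacent_cases hs hsu with rfl | rfl | rfl | rfl
    · exact case_t₁ hn hmenu hposOr hFd hball hdoz hds
    · exact case_t₂ hn hmenu hposOr hFd hball hdoz hds
    · exact case_t₃ hq hn hmenu hposOr hFd hd1 hball hp0 hdoz hA hds
    · exact case_t₄ hq hn hmenu hposOr hFd hd1 hball hp0 hdoz hB hds
  · exact case_far hq hn hmenu hposOr hFd hd1 hball hdoz hA hB hfar hd0

end HRowEndModel

end Summit.Ventures.Crystal3D.Theorems

end
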